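import Mathlib.Combinatorics.SimpleGraph.Coloring.Vertex
import Mathlib.Data.Fintype.BigOperators
import Mathlib.Data.Fintype.Option
import Mathlib.Data.Fintype.Powerset
import Mathlib.Data.Fintype.Prod
import Mathlib.Data.Fintype.Sum
import Mathlib.Logic.Equiv.Basic
import Mathlib.Tactic.Ring
import Mathlib.Tactic.NormNum
import Mathlib.Tactic.Push
import HarnessLib

/-!
# The blow-up of Lemma 9 of Dyer–Goldberg–Greenhill–Jerrum (2003): counting identities

M. Dyer, L. A. Goldberg, C. Greenhill, M. Jerrum, *The relative complexity of approximate counting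
problems*, Algorithmica 38 (2003) 471–500 (`DyerEtAl2003`), Lemma 9 ("`#DOWNSETS ≤_AP #BIS`"),
proof (p. 11 of the preprint): given a partial order `(X, ≼)`, `X = [n]`, "let `{U_i, V_i : i ∈ X}`
be a collection of disjoint sets with `|U_i| = |V_i| = 2n`. Then define `U = ⋃ U_i`, `V = ⋃ V_i`,
and `E = {(u, v) : u ∈ U_i ∧ v ∈ V_j ∧ i ≼ j}` … Call an independent set `I ∈ 𝓘(B)` *full* iff
`I ∩ (U_i ∪ V_i) ≠ ∅` for all `i ∈ X`. … Every full independent set `I ∈ 𝓘'(B)` corresponds to a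
downset `D = {i ∈ X : I ∩ V_i ≠ ∅}`, and every downset `D ∈ 𝓓(X, ≼)` arises from exactly
`(2^{2n} − 1)^n` full independent sets `I` in this way; thus `|𝓘'(B)| = (2^{2n} − 1)^n · |𝓓(X, ≼)|`.
By a crude estimation of non-full independent sets, `|𝓘(B) ∖ 𝓘'(B)| ≤ 3^n (2^{2n} − 1)^{n−1}`.
Since `3^n (2^{2n} − 1)^{n−1} / (2^{2n} − 1)^n < 1/4` (at least for `n ≥ 5`),
`|𝓓(X, ≼)| = ⌊|𝓘(B)| / (2^{2n} − 1)^n⌋`."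

This file PROVES these identities, for the blow-up `blowup R m` of an arbitrary REFLEXIVE relation
`R` on a finite type `X` with blocks of an arbitrary size `m` (the argument uses only
`i ≼ i`, never antisymmetry or transitivity, so no passage to strongly connected components is
needed; "downsets" are the `R`-lower sets `IsLowerFinset R D : R i j → j ∈ D → i ∈ D`):

* `card_fullIndep_eq` — full independent sets are `(2^m − 1)^{|X|}`-to-one over lower sets
  (an explicit equivalence `fullIndepEquiv` with `{lower sets} × (X → {nonempty subsets of Fin m})`);
* `card_nonfullIndep_le` — the non-full independent sets number at most `3^{|X|} (2^m − 1)^{|X|−1}`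
  (an explicit injection into `(X → Option Bool) × ({j // j ≠ x₀} → {nonempty subsets of Fin m})`:
  the pattern "misses / meets `U_i` / meets `V_i`" of each block, and the traces on the blocks other
  than a hole);
* `card_indep_div_eq` — hence `⌊#independent sets / (2^m − 1)^{|X|}⌋ = #lower sets` as soon as
  `4 · 3^{|X|} < 2^m − 1`, which for `m = 2n`, `n = |X| ≥ 5` is the printed threshold
  (`four_mul_three_pow_lt_of_five_le`), together with the two-sided estimate
  `0 ≤ #indep − (2^m − 1)^{|X|} · #lower < (2^m − 1)^{|X|} / 4` used by the rounding step of the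
  AP-reduction (`card_indep_sub_lt`).

Independent sets are written as in the tree's `bisCount` (`FPRAS.lean`):
`∀ v ∈ S, ∀ w ∈ S, ¬ Adj v w` for `S : Finset _`. The link with the code-word counting functions
`downsetCount` / `bisCount` is made in `BISDownsets.lean`; the oracle Turing machine of the
AP-reduction is not formalised.
-/

namespace Literature.Computability.Complexity.DyerEtAl2003

open Finset

/-- Vertex type of the blow-up of a relation on `X` with blocks of size `m`: `Sum.inl (i, a)` is the
`a`-th vertex of the block `U_i`, `Sum.inr (i, a)` the `a`-th vertex of the block `V_i`.
[cite: DyerEtAl2003, Lemma 9 (proof)] -/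
abbrev BlowupVertex (X : Type) (m : ℕ) : Type := (X × Fin m) ⊕ (X × Fin m)

section Graph

variable {X : Type} (R : X → X → Prop) (m : ℕ)

/-- Adjacency of the blow-up: `U_i`–`V_j` is complete bipartite iff `R i j` ("`u ∈ U_i ∧ v ∈ V_j ∧
i ≼ j`"), no edges inside `U` or inside `V`. [cite: DyerEtAl2003, Lemma 9 (proof)] -/
def blowupAdj : BlowupVertex X m → BlowupVertex X m → Prop
  | Sum.inl p, Sum.inr q => R p.1 q.1
  | Sum.inr q, Sum.inl p => R p.1 q.1
  | Sum.inl _, Sum.inl _ => False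
  | Sum.inr _, Sum.inr _ => False

/-- `U_i`–`V_j` adjacency. [folklore] -/
@[simp] theorem blowupAdj_inl_inr (p q : X × Fin m) :
    blowupAdj R m (Sum.inl p) (Sum.inr q) ↔ R p.1 q.1 := Iff.rfl

/-- `V_j`–`U_i` adjacency. [folklore] -/
@[simp] theorem blowupAdj_inr_inl (p q : X × Fin m) :
    blowupAdj R m (Sum.inr q) (Sum.inl p) ↔ R p.1 q.1 := Iff.rfl

/-- No edges inside `U`. [folklore] -/
@[simp] theorem not_blowupAdj_inl_inl (p q : X × Fin m) :
    ¬ blowupAdj R m (Sum.inl p) (Sum.inl q) := fun h => h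

/-- No edges inside `V`. [folklore] -/
@[simp] theorem not_blowupAdj_inr_inr (p q : X × Fin m) :
    ¬ blowupAdj R m (Sum.inr p) (Sum.inr q) := fun h => h

/-- Adjacency of the blow-up is decidable when `R` is (by cases on the sides). [folklore] -/
instance blowupAdj.decidableRel [DecidableRel R] : DecidableRel (blowupAdj R m) := fun v w =>
  match v, w with
  | Sum.inl p, Sum.inr q => inferInstanceAs (Decidable (R p.1 q.1))
  | Sum.inr q, Sum.inl p => inferInstanceAs (Decidable (R p.1 q.1))
  | Sum.inl _, Sum.inl _ => inferInstanceAs (Decidable False)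
  | Sum.inr _, Sum.inr _ => inferInstanceAs (Decidable False)

/-- **The blow-up graph `B` of Lemma 9**: the bipartite graph on `U ∪ V`, `U = ⋃ U_i`,
`V = ⋃ V_i`, `|U_i| = |V_i| = m`, with `U_i`–`V_j` complete bipartite iff `R i j`.
[cite: DyerEtAl2003, Lemma 9 (proof)] -/
def blowup : SimpleGraph (BlowupVertex X m) where
  Adj := blowupAdj R m
  symm := ⟨fun v w h => by
    rcases v with p | p <;> rcases w with q | q <;> exact h⟩
  loopless := ⟨fun v h => by
    rcases v with p | p <;> exact h⟩

/-- Adjacency of `blowup R m` is decidable when `R` is. [folklore] -/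
instance blowup.decidableRelAdj [DecidableRel R] : DecidableRel (blowup R m).Adj :=
  inferInstanceAs (DecidableRel (blowupAdj R m))

/-- Unfolding lemma for the adjacency of `blowup`. [folklore] -/
@[simp] theorem blowup_adj (v w : BlowupVertex X m) : (blowup R m).Adj v w ↔ blowupAdj R m v w :=
  Iff.rfl

/-- The blow-up is bipartite: colour `U` by `0` and `V` by `1`. [cite: DyerEtAl2003, Lemma 9 (proof)] -/
theorem blowup_colorable_two : (blowup R m).Colorable 2 := by
  refine ⟨SimpleGraph.Coloring.mk (fun v => Sum.elim (fun _ => 0) (fun _ => 1) v) ?_⟩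
  rintro (p | p) (q | q) h
  · exact (not_blowupAdj_inl_inl R m p q h).elim
  · simp
  · simp
  · exact (not_blowupAdj_inr_inr R m p q h).elim

end Graph

section Counting

variable {X : Type} [Fintype X] [DecidableEq X] (R : X → X → Prop) [DecidableRel R] (m : ℕ)

/-- Independent vertex sets of the blow-up, in the shape of the tree's `bisCount`:
no two members are adjacent. [folklore] -/
def IsBlowupIndep (S : Finset (BlowupVertex X m)) : Prop :=
  ∀ v ∈ S, ∀ w ∈ S, ¬ blowupAdj R m v w

/-- *Full* sets: `S ∩ (U_i ∪ V_i) ≠ ∅` for every `i`. [cite: DyerEtAl2003, Lemma 9 (proof)] -/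
def IsFull (S : Finset (BlowupVertex X m)) : Prop :=
  ∀ i : X, ∃ a : Fin m, Sum.inl (i, a) ∈ S ∨ Sum.inr (i, a) ∈ S

/-- Lower sets ("downsets") of the relation `R` read as `≼`: `R i j`, `j ∈ D ⇒ i ∈ D`.
[cite: DyerEtAl2003, §4 (problem #DOWNSETS)] -/
def IsLowerFinset (D : Finset X) : Prop :=
  ∀ ⦃i j : X⦄, R i j → j ∈ D → i ∈ D

/-- Independence is decidable. [folklore] -/
instance IsBlowupIndep.decidablePred : DecidablePred (IsBlowupIndep R m) := fun S =>
  inferInstanceAs (Decidable (∀ v ∈ S, ∀ w ∈ S, ¬ blowupAdj R m v w))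

/-- Fullness is decidable. [folklore] -/
instance IsFull.decidablePred : DecidablePred (IsFull (X := X) m) := fun S =>
  inferInstanceAs (Decidable (∀ i : X, ∃ a : Fin m, Sum.inl (i, a) ∈ S ∨ Sum.inr (i, a) ∈ S))

/-- Being a lower set is decidable. [folklore] -/
instance IsLowerFinset.decidablePred : DecidablePred (IsLowerFinset R) := fun D =>
  inferInstanceAs (Decidable (∀ ⦃i j : X⦄, R i j → j ∈ D → i ∈ D))

variable {R m}

omit [Fintype X] [DecidableEq X] [DecidableRel R] in
/-- In an independent set no block index has vertices on both sides (`U_i`–`V_i` is complete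
because `R i i`). [cite: DyerEtAl2003, Lemma 9 (proof)] -/
theorem IsBlowupIndep.not_inl_inr (hR : ∀ i : X, R i i) {S : Finset (BlowupVertex X m)}
    (hS : IsBlowupIndep R m S) {i : X} {a b : Fin m}
    (ha : Sum.inl (i, a) ∈ S) (hb : Sum.inr (i, b) ∈ S) : False :=
  hS _ ha _ hb (hR i)

/-! #### The data of an independent set: the blocks met on the `V` side and the traces -/

variable (m) in
/-- `D(S) = {i ∈ X : S ∩ V_i ≠ ∅}` (the downset attached to a full independent set).
[cite: DyerEtAl2003, Lemma 9 (proof)] -/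
def blocksV (S : Finset (BlowupVertex X m)) : Finset X :=
  univ.filter fun i => ∃ a : Fin m, Sum.inr (i, a) ∈ S

/-- The trace of `S` on the block pair `U_i ∪ V_i`, as a set of positions. [folklore] -/
def traceAt (S : Finset (BlowupVertex X m)) (i : X) : Finset (Fin m) :=
  univ.filter fun a => Sum.inl (i, a) ∈ S ∨ Sum.inr (i, a) ∈ S

omit [Fintype X] in
/-- Membership in `traceAt`. [folklore] -/
@[simp] theorem mem_traceAt (S : Finset (BlowupVertex X m)) (i : X) (a : Fin m) :
    a ∈ traceAt S i ↔ Sum.inl (i, a) ∈ S ∨ Sum.inr (i, a) ∈ S := by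
  simp [traceAt]

/-- Membership in `blocksV`. [folklore] -/
@[simp] theorem mem_blocksV (S : Finset (BlowupVertex X m)) (i : X) :
    i ∈ blocksV m S ↔ ∃ a : Fin m, Sum.inr (i, a) ∈ S := by
  simp [blocksV]

/-- Membership predicate of the set rebuilt from a pair (`D`, traces `T`): `U_i` carries `T i` for
`i ∉ D`, `V_i` carries `T i` for `i ∈ D`. [cite: DyerEtAl2003, Lemma 9 (proof)] -/
def MemOfData (D : Finset X) (T : X → Finset (Fin m)) : BlowupVertex X m → Prop
  | Sum.inl p => p.1 ∉ D ∧ p.2 ∈ T p.1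
  | Sum.inr p => p.1 ∈ D ∧ p.2 ∈ T p.1

/-- `MemOfData D T` is decidable. [folklore] -/
instance MemOfData.decidablePred (D : Finset X) (T : X → Finset (Fin m)) :
    DecidablePred (MemOfData D T) := fun v =>
  match v with
  | Sum.inl p => inferInstanceAs (Decidable (p.1 ∉ D ∧ p.2 ∈ T p.1))
  | Sum.inr p => inferInstanceAs (Decidable (p.1 ∈ D ∧ p.2 ∈ T p.1))

/-- The vertex set rebuilt from (`D`, `T`). [cite: DyerEtAl2003, Lemma 9 (proof)] -/
def ofData (D : Finset X) (T : X → Finset (Fin m)) : Finset (BlowupVertex X m) :=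
  univ.filter (MemOfData D T)

/-- `U`-membership in `ofData`. [folklore] -/
@[simp] theorem inl_mem_ofData (D : Finset X) (T : X → Finset (Fin m)) (i : X) (a : Fin m) :
    Sum.inl (i, a) ∈ ofData D T ↔ i ∉ D ∧ a ∈ T i := by
  simp [ofData, MemOfData]

/-- `V`-membership in `ofData`. [folklore] -/
@[simp] theorem inr_mem_ofData (D : Finset X) (T : X → Finset (Fin m)) (i : X) (a : Fin m) :
    Sum.inr (i, a) ∈ ofData D T ↔ i ∈ D ∧ a ∈ T i := by
  simp [ofData, MemOfData]

omit [DecidableRel R] in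
/-- A rebuilt set is independent as soon as `D` is a lower set. [cite: DyerEtAl2003, Lemma 9 (proof)] -/
theorem isBlowupIndep_ofData {D : Finset X} (hD : IsLowerFinset R D) (T : X → Finset (Fin m)) :
    IsBlowupIndep R m (ofData D T) := by
  rintro (p | p) hp (q | q) hq h
  · exact h
  · rw [blowupAdj_inl_inr] at h
    obtain ⟨i, a⟩ := p
    obtain ⟨j, b⟩ := q
    rw [inl_mem_ofData] at hp
    rw [inr_mem_ofData] at hq
    exact hp.1 (hD h hq.1)
  · rw [blowupAdj_inr_inl] at h
    obtain ⟨j, b⟩ := p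
    obtain ⟨i, a⟩ := q
    rw [inr_mem_ofData] at hp
    rw [inl_mem_ofData] at hq
    exact hq.1 (hD h hp.1)
  · exact h

/-- A rebuilt set is full as soon as every trace is nonempty. [cite: DyerEtAl2003, Lemma 9 (proof)] -/
theorem isFull_ofData (D : Finset X) {T : X → Finset (Fin m)} (hT : ∀ i, (T i).Nonempty) :
    IsFull m (ofData D T) := by
  intro i
  obtain ⟨a, ha⟩ := hT i
  refine ⟨a, ?_⟩
  by_cases hi : i ∈ D
  · exact Or.inr ((inr_mem_ofData D T i a).2 ⟨hi, ha⟩)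
  · exact Or.inl ((inl_mem_ofData D T i a).2 ⟨hi, ha⟩)

omit [DecidableRel R] in
/-- For a full independent set, `D(S)` is a lower set: if `R i j` and `S` meets `V_j` then `S`
misses `U_i` (edge `U_i`–`V_j`), hence meets `V_i` (fullness). [cite: DyerEtAl2003, Lemma 9 (proof)] -/
theorem isLowerFinset_blocksV {S : Finset (BlowupVertex X m)}
    (hS : IsBlowupIndep R m S) (hF : IsFull m S) : IsLowerFinset R (blocksV m S) := by
  intro i j hij hj
  rw [mem_blocksV] at hj ⊢
  obtain ⟨b, hb⟩ := hj
  obtain ⟨a, ha | ha⟩ := hF i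
  · exact (hS _ ha _ hb hij).elim
  · exact ⟨a, ha⟩

omit [DecidableRel R] in
/-- Rebuilding an independent set from its data gives it back.
[cite: DyerEtAl2003, Lemma 9 (proof)] -/
theorem ofData_blocksV_traceAt (hR : ∀ i : X, R i i) {S : Finset (BlowupVertex X m)}
    (hS : IsBlowupIndep R m S) : ofData (blocksV m S) (traceAt S) = S := by
  ext v
  rcases v with ⟨i, a⟩ | ⟨i, a⟩
  · rw [inl_mem_ofData, mem_blocksV, mem_traceAt]
    constructor
    · rintro ⟨hno, h | h⟩
      · exact h
      · exact (hno ⟨a, h⟩).elim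
    · intro h
      exact ⟨fun ⟨b, hb⟩ => hS.not_inl_inr hR h hb, Or.inl h⟩
  · rw [inr_mem_ofData, mem_blocksV, mem_traceAt]
    constructor
    · rintro ⟨⟨b, hb⟩, h | h⟩
      · exact (hS.not_inl_inr hR h hb).elim
      · exact h
    · intro h
      exact ⟨⟨a, h⟩, Or.inr h⟩

/-- The data of a rebuilt set: `D` is recovered when all traces are nonempty. [folklore] -/
theorem blocksV_ofData (D : Finset X) {T : X → Finset (Fin m)} (hT : ∀ i, (T i).Nonempty) :
    blocksV m (ofData D T) = D := by
  ext i
  rw [mem_blocksV]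
  constructor
  · rintro ⟨a, ha⟩
    exact ((inr_mem_ofData D T i a).1 ha).1
  · intro hi
    obtain ⟨a, ha⟩ := hT i
    exact ⟨a, (inr_mem_ofData D T i a).2 ⟨hi, ha⟩⟩

/-- The data of a rebuilt set: the traces are recovered. [folklore] -/
theorem traceAt_ofData (D : Finset X) (T : X → Finset (Fin m)) (i : X) :
    traceAt (ofData D T) i = T i := by
  ext a
  rw [mem_traceAt, inl_mem_ofData, inr_mem_ofData]
  by_cases hi : i ∈ D <;> simp [hi]

/-! #### Full independent sets are `(2^m − 1)^{|X|}`-to-one over lower sets -/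

variable (R m) in
/-- **The correspondence of Lemma 9**: full independent sets of the blow-up `≃` (lower sets of `R`)
`×` (a nonempty trace in each of the `|X|` blocks). [cite: DyerEtAl2003, Lemma 9 (proof)] -/
def fullIndepEquiv (hR : ∀ i : X, R i i) :
    {S : Finset (BlowupVertex X m) // IsBlowupIndep R m S ∧ IsFull m S} ≃
      {D : Finset X // IsLowerFinset R D} × (X → {T : Finset (Fin m) // T.Nonempty}) where
  toFun S := (⟨blocksV m S.1, isLowerFinset_blocksV S.2.1 S.2.2⟩,
    fun i => ⟨traceAt S.1 i, by
      obtain ⟨a, ha⟩ := S.2.2 i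
      exact ⟨a, (mem_traceAt S.1 i a).2 ha⟩⟩)
  invFun p := ⟨ofData p.1.1 fun i => (p.2 i).1,
    isBlowupIndep_ofData p.1.2 _, isFull_ofData p.1.1 fun i => (p.2 i).2⟩
  left_inv S := Subtype.ext (ofData_blocksV_traceAt hR S.2.1)
  right_inv p := by
    obtain ⟨⟨D, hD⟩, T⟩ := p
    refine Prod.ext (Subtype.ext ?_) (funext fun i => Subtype.ext ?_)
    · exact blocksV_ofData D fun i => (T i).2
    · exact traceAt_ofData D (fun i => (T i).1) i

/-- There are `2^m − 1` nonempty subsets of a block of size `m`. [folklore] -/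
theorem card_nonempty_finset_fin (m : ℕ) :
    Fintype.card {T : Finset (Fin m) // T.Nonempty} = 2 ^ m - 1 := by
  rw [Fintype.card_subtype]
  have h : (univ.filter fun T : Finset (Fin m) => T.Nonempty) = univ.erase ∅ := by
    ext T
    simp [Finset.nonempty_iff_ne_empty]
  rw [h, Finset.card_erase_of_mem (mem_univ _), Finset.card_univ, Fintype.card_finset,
    Fintype.card_fin]

variable (R m) in
/-- **`|𝓘'(B)| = (2^m − 1)^{|X|} · |𝓓|`**: the number of full independent sets of the blow-up is
`(2^m − 1)^{|X|}` times the number of lower sets. [cite: DyerEtAl2003, Lemma 9 (proof)] -/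
theorem card_fullIndep_eq (hR : ∀ i : X, R i i) :
    (univ.filter fun S : Finset (BlowupVertex X m) => IsBlowupIndep R m S ∧ IsFull m S).card =
      (2 ^ m - 1) ^ Fintype.card X * (univ.filter fun D : Finset X => IsLowerFinset R D).card := by
  rw [← Fintype.card_subtype, ← Fintype.card_subtype, Fintype.card_congr (fullIndepEquiv R m hR),
    Fintype.card_prod, Fintype.card_fun, card_nonempty_finset_fin, mul_comm]

/-! #### Non-full independent sets: at most `3^{|X|} (2^m − 1)^{|X|−1}` -/

/-- The block pattern of `S` at `i`: `some true` if `S` meets `V_i`, else `some false` if `S` meets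
`U_i`, else `none` ("three possibilities" per block in the crude estimate).
[cite: DyerEtAl2003, Lemma 9 (proof)] -/
def pattern (S : Finset (BlowupVertex X m)) (i : X) : Option Bool :=
  if ∃ a : Fin m, Sum.inr (i, a) ∈ S then some true
  else if ∃ a : Fin m, Sum.inl (i, a) ∈ S then some false else none

omit [Fintype X] [DecidableRel R] in
/-- Reconstruction of the `U`-part of an independent set from pattern and trace. [folklore] -/
theorem inl_mem_iff_pattern (hR : ∀ i : X, R i i) {S : Finset (BlowupVertex X m)}
    (hS : IsBlowupIndep R m S) (i : X) (a : Fin m) :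
    Sum.inl (i, a) ∈ S ↔ pattern S i = some false ∧ a ∈ traceAt S i := by
  rw [mem_traceAt]
  unfold pattern
  constructor
  · intro h
    have h1 : ¬ ∃ b : Fin m, Sum.inr (i, b) ∈ S := fun ⟨b, hb⟩ => hS.not_inl_inr hR h hb
    have h2 : ∃ b : Fin m, Sum.inl (i, b) ∈ S := ⟨a, h⟩
    simp only [h1, if_false, h2, if_true, true_and]
    exact Or.inl h
  · rintro ⟨hp, h | h⟩
    · exact h
    · have h1 : ∃ b : Fin m, Sum.inr (i, b) ∈ S := ⟨a, h⟩
      simp [h1] at hp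

omit [Fintype X] [DecidableRel R] in
/-- Reconstruction of the `V`-part of an independent set from pattern and trace. [folklore] -/
theorem inr_mem_iff_pattern (hR : ∀ i : X, R i i) {S : Finset (BlowupVertex X m)}
    (hS : IsBlowupIndep R m S) (i : X) (a : Fin m) :
    Sum.inr (i, a) ∈ S ↔ pattern S i = some true ∧ a ∈ traceAt S i := by
  rw [mem_traceAt]
  unfold pattern
  constructor
  · intro h
    have h1 : ∃ b : Fin m, Sum.inr (i, b) ∈ S := ⟨a, h⟩
    simp only [h1, if_true, true_and]
    exact Or.inr h
  · rintro ⟨hp, h | h⟩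
    · have h1 : ¬ ∃ b : Fin m, Sum.inr (i, b) ∈ S := fun ⟨b, hb⟩ => hS.not_inl_inr hR h hb
      simp [h1] at hp
    · exact h

omit [Fintype X] [DecidableRel R] in
/-- A block with pattern `none` carries no vertex of `S`. [folklore] -/
theorem pattern_eq_none_iff (S : Finset (BlowupVertex X m)) (i : X) :
    pattern S i = none ↔ ∀ a : Fin m, Sum.inl (i, a) ∉ S ∧ Sum.inr (i, a) ∉ S := by
  unfold pattern
  by_cases h1 : ∃ a : Fin m, Sum.inr (i, a) ∈ S
  · simp only [h1, if_true, reduceCtorEq, false_iff, not_forall, not_and, not_not]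
    obtain ⟨a, ha⟩ := h1
    exact ⟨a, fun _ => ha⟩
  · by_cases h2 : ∃ a : Fin m, Sum.inl (i, a) ∈ S
    · simp only [h1, if_false, h2, if_true, reduceCtorEq, false_iff, not_forall, not_and]
      obtain ⟨a, ha⟩ := h2
      exact ⟨a, fun h => (h ha).elim⟩
    · simp only [h1, if_false, h2, true_iff]
      push Not at h1 h2
      exact fun a => ⟨h2 a, h1 a⟩

omit [Fintype X] [DecidableRel R] in
/-- Non-full sets are those with a hole in their pattern. [folklore] -/
theorem not_isFull_iff (S : Finset (BlowupVertex X m)) :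
    ¬ IsFull m S ↔ ∃ i : X, pattern S i = none := by
  simp only [IsFull, not_forall, not_exists, not_or, pattern_eq_none_iff]

omit [Fintype X] [DecidableRel R] in
/-- A block whose pattern is not `none` has a nonempty trace. [folklore] -/
theorem traceAt_nonempty_of_pattern_ne_none {S : Finset (BlowupVertex X m)} {i : X}
    (h : pattern S i ≠ none) : (traceAt S i).Nonempty := by
  rw [Ne, pattern_eq_none_iff] at h
  push Not at h
  obtain ⟨a, ha⟩ := h
  refine ⟨a, (mem_traceAt S i a).2 ?_⟩
  by_cases h1 : Sum.inl (i, a) ∈ S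
  · exact Or.inl h1
  · exact Or.inr (ha h1)

omit [Fintype X] [DecidableRel R] in
/-- **An independent set is determined by its pattern and its traces on the blocks it meets.**
[cite: DyerEtAl2003, Lemma 9 (proof)] -/
theorem eq_of_pattern_eq_of_traceAt_eq (hR : ∀ i : X, R i i) {S₁ S₂ : Finset (BlowupVertex X m)}
    (h₁ : IsBlowupIndep R m S₁) (h₂ : IsBlowupIndep R m S₂) (hp : pattern S₁ = pattern S₂)
    (ht : ∀ i : X, pattern S₁ i ≠ none → traceAt S₁ i = traceAt S₂ i) : S₁ = S₂ := by
  ext v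
  rcases v with ⟨i, a⟩ | ⟨i, a⟩
  · rw [inl_mem_iff_pattern hR h₁, inl_mem_iff_pattern hR h₂, ← hp]
    constructor
    · rintro ⟨hpi, ha⟩
      exact ⟨hpi, by rwa [← ht i (by simp [hpi])]⟩
    · rintro ⟨hpi, ha⟩
      exact ⟨hpi, by rwa [ht i (by simp [hpi])]⟩
  · rw [inr_mem_iff_pattern hR h₁, inr_mem_iff_pattern hR h₂, ← hp]
    constructor
    · rintro ⟨hpi, ha⟩
      exact ⟨hpi, by rwa [← ht i (by simp [hpi])]⟩
    · rintro ⟨hpi, ha⟩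
      exact ⟨hpi, by rwa [ht i (by simp [hpi])]⟩

/-- A hole of a pattern (some block with pattern `none`, if any; else the base point `x₀`).
[folklore] -/
noncomputable def hole (x₀ : X) (τ : X → Option Bool) : X :=
  if h : ∃ i, τ i = none then h.choose else x₀

omit [DecidableEq X] in
/-- The hole is a hole. [folklore] -/
theorem apply_hole (x₀ : X) {τ : X → Option Bool} (h : ∃ i, τ i = none) : τ (hole x₀ τ) = none := by
  simp only [hole, h, dite_true]
  exact h.choose_spec

/-- Coercion of a trace to a nonempty set (nonempty traces are kept; `m > 0`). [folklore] -/
def toNonempty (hm : 0 < m) (T : Finset (Fin m)) : {T : Finset (Fin m) // T.Nonempty} :=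
  if h : T.Nonempty then ⟨T, h⟩ else ⟨univ, ⟨⟨0, hm⟩, mem_univ _⟩⟩

/-- `toNonempty` keeps nonempty sets. [folklore] -/
theorem toNonempty_val (hm : 0 < m) {T : Finset (Fin m)} (h : T.Nonempty) :
    (toNonempty hm T).1 = T := by
  simp [toNonempty, h]

/-- **The code of a non-full independent set** in a set of size `3^{|X|} (2^m − 1)^{|X|−1}`: its
pattern, and the (nonempty) traces on the blocks other than the hole, re-indexed by `{j // j ≠ x₀}`
through the transposition `(x₀ hole)`. [cite: DyerEtAl2003, Lemma 9 (proof: "crude estimation of non-full independent sets")] -/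
noncomputable def nonfullCode (x₀ : X) (hm : 0 < m) (S : Finset (BlowupVertex X m)) :
    (X → Option Bool) × ({j : X // j ≠ x₀} → {T : Finset (Fin m) // T.Nonempty}) :=
  (pattern S, fun j => toNonempty hm (traceAt S (Equiv.swap x₀ (hole x₀ (pattern S)) j.1)))

omit [DecidableRel R] in
/-- The code is injective on non-full independent sets. [cite: DyerEtAl2003, Lemma 9 (proof)] -/
theorem nonfullCode_injective (hR : ∀ i : X, R i i) (x₀ : X) (hm : 0 < m)
    {S₁ S₂ : Finset (BlowupVertex X m)} (h₁ : IsBlowupIndep R m S₁) (hF₁ : ¬ IsFull m S₁)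
    (h₂ : IsBlowupIndep R m S₂) (h : nonfullCode x₀ hm S₁ = nonfullCode x₀ hm S₂) : S₁ = S₂ := by
  simp only [nonfullCode, Prod.mk.injEq] at h
  obtain ⟨hp, ht⟩ := h
  refine eq_of_pattern_eq_of_traceAt_eq hR h₁ h₂ hp fun i hi => ?_
  set i₀ := hole x₀ (pattern S₁) with hi₀
  have hhole : pattern S₁ i₀ = none := apply_hole x₀ ((not_isFull_iff S₁).1 hF₁)
  have hne : i ≠ i₀ := fun h => hi (h ▸ hhole)
  -- the block `i` is read off position `j = swap x₀ i₀ i ≠ x₀`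
  have hj : Equiv.swap x₀ i₀ i ≠ x₀ := by
    intro h
    have : i = i₀ := by
      have h' := congrArg (Equiv.swap x₀ i₀) h
      rwa [Equiv.swap_apply_self, Equiv.swap_apply_left] at h'
    exact hne this
  have hti := congrFun ht ⟨Equiv.swap x₀ i₀ i, hj⟩
  simp only [← hp] at hti
  rw [← hi₀, Equiv.swap_apply_self] at hti
  have hn₁ : (traceAt S₁ i).Nonempty := traceAt_nonempty_of_pattern_ne_none hi
  have hn₂ : (traceAt S₂ i).Nonempty := traceAt_nonempty_of_pattern_ne_none (hp ▸ hi)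
  have := congrArg Subtype.val hti
  rwa [toNonempty_val hm hn₁, toNonempty_val hm hn₂] at this

/-- `|{j // j ≠ x₀}| = |X| − 1`. [folklore] -/
theorem card_subtype_ne (x₀ : X) : Fintype.card {j : X // j ≠ x₀} = Fintype.card X - 1 := by
  rw [Fintype.card_subtype, Finset.filter_ne', Finset.card_erase_of_mem (mem_univ _),
    Finset.card_univ]

variable (R m) in
/-- **`|𝓘(B) ∖ 𝓘'(B)| ≤ 3^{|X|} (2^m − 1)^{|X|−1}`**: the crude bound on non-full independent sets
(three patterns per block, at most `|X| − 1` nonempty traces). [cite: DyerEtAl2003, Lemma 9 (proof)] -/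
theorem card_nonfullIndep_le (hR : ∀ i : X, R i i) (hm : 0 < m) :
    (univ.filter fun S : Finset (BlowupVertex X m) => IsBlowupIndep R m S ∧ ¬ IsFull m S).card ≤
      3 ^ Fintype.card X * (2 ^ m - 1) ^ (Fintype.card X - 1) := by
  rcases isEmpty_or_nonempty X with hX | ⟨⟨x₀⟩⟩
  · have h0 : (univ.filter fun S : Finset (BlowupVertex X m) =>
        IsBlowupIndep R m S ∧ ¬ IsFull m S) = ∅ := by
      refine Finset.filter_eq_empty_iff.2 fun S _ h => h.2 fun i => (IsEmpty.false i).elim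
    rw [h0, Finset.card_empty]
    exact Nat.zero_le _
  · rw [← Fintype.card_subtype]
    let f : {S : Finset (BlowupVertex X m) // IsBlowupIndep R m S ∧ ¬ IsFull m S} →
        (X → Option Bool) × ({j : X // j ≠ x₀} → {T : Finset (Fin m) // T.Nonempty}) :=
      fun S => nonfullCode x₀ hm S.1
    have hf : Function.Injective f := fun S₁ S₂ h =>
      Subtype.ext (nonfullCode_injective hR x₀ hm S₁.2.1 S₁.2.2 S₂.2.1 h)
    refine (Fintype.card_le_of_injective f hf).trans ?_
    rw [Fintype.card_prod, Fintype.card_fun, Fintype.card_fun, Fintype.card_option,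
      Fintype.card_bool, card_nonempty_finset_fin, card_subtype_ne]

/-! #### The floor identity of Lemma 9 -/

variable (R m) in
/-- Independent sets split into full and non-full ones:
`|𝓘(B)| = (2^m − 1)^{|X|} · |𝓓| + |𝓘(B) ∖ 𝓘'(B)|`. [cite: DyerEtAl2003, Lemma 9 (proof)] -/
theorem card_indep_eq_add (hR : ∀ i : X, R i i) :
    (univ.filter fun S : Finset (BlowupVertex X m) => IsBlowupIndep R m S).card =
      (2 ^ m - 1) ^ Fintype.card X * (univ.filter fun D : Finset X => IsLowerFinset R D).card +
        (univ.filter fun S : Finset (BlowupVertex X m) => IsBlowupIndep R m S ∧ ¬ IsFull m S).card := by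
  rw [← card_fullIndep_eq R m hR, ← Finset.filter_filter, ← Finset.filter_filter,
    Finset.card_filter_add_card_filter_not]

variable (R m) in
/-- **The two-sided estimate behind the rounding step**: with `q = 2^m − 1` and `n = |X|`,
`q^n · |𝓓| ≤ |𝓘(B)|` and `4 · (|𝓘(B)| − q^n · |𝓓|) < q^n` whenever `4 · 3^n < q` (for `m = 2n`
this is `n ≥ 5`, `four_mul_three_pow_lt_of_five_le`). [cite: DyerEtAl2003, Lemma 9 (proof)] -/
theorem card_indep_sub_lt (hR : ∀ i : X, R i i) (h : 4 * 3 ^ Fintype.card X < 2 ^ m - 1) :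
    (2 ^ m - 1) ^ Fintype.card X * (univ.filter fun D : Finset X => IsLowerFinset R D).card ≤
        (univ.filter fun S : Finset (BlowupVertex X m) => IsBlowupIndep R m S).card ∧
      4 * ((univ.filter fun S : Finset (BlowupVertex X m) => IsBlowupIndep R m S).card -
          (2 ^ m - 1) ^ Fintype.card X * (univ.filter fun D : Finset X => IsLowerFinset R D).card) <
        (2 ^ m - 1) ^ Fintype.card X := by
  rw [card_indep_eq_add R m hR, Nat.add_sub_cancel_left]
  refine ⟨Nat.le_add_right _ _, ?_⟩
  have hm : 0 < m := by
    rcases Nat.eq_zero_or_pos m with rfl | hm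
    · simp at h
    · exact hm
  have hq : 0 < 2 ^ m - 1 := lt_of_le_of_lt (Nat.zero_le _) h
  rcases Nat.eq_zero_or_pos (Fintype.card X) with hX | hX
  · -- no blocks: every set is full
    have h0 : (univ.filter fun S : Finset (BlowupVertex X m) =>
        IsBlowupIndep R m S ∧ ¬ IsFull m S) = ∅ := by
      refine Finset.filter_eq_empty_iff.2 fun S _ h' => h'.2 fun i => ?_
      exact ((Fintype.card_eq_zero_iff.1 hX).false i).elim
    rw [h0, Finset.card_empty, mul_zero]
    exact pow_pos hq _
  · calc 4 * (univ.filter fun S : Finset (BlowupVertex X m) =>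
            IsBlowupIndep R m S ∧ ¬ IsFull m S).card
        ≤ 4 * (3 ^ Fintype.card X * (2 ^ m - 1) ^ (Fintype.card X - 1)) :=
          Nat.mul_le_mul_left 4 (card_nonfullIndep_le R m hR hm)
      _ = 4 * 3 ^ Fintype.card X * (2 ^ m - 1) ^ (Fintype.card X - 1) := by ring
      _ < (2 ^ m - 1) * (2 ^ m - 1) ^ (Fintype.card X - 1) :=
          Nat.mul_lt_mul_of_pos_right h (pow_pos hq _)
      _ = (2 ^ m - 1) ^ Fintype.card X := by
          rw [← pow_succ']
          congr 1
          omega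

variable (R m) in
/-- **`|𝓓(X, ≼)| = ⌊|𝓘(B)| / (2^m − 1)^{|X|}⌋`** (Lemma 9): the number of lower sets of the
reflexive relation `R` is the integer quotient of the number of independent sets of its blow-up
by `(2^m − 1)^{|X|}`, as soon as `4 · 3^{|X|} < 2^m − 1`. [cite: DyerEtAl2003, Lemma 9 (proof)] -/
theorem card_indep_div_eq (hR : ∀ i : X, R i i) (h : 4 * 3 ^ Fintype.card X < 2 ^ m - 1) :
    (univ.filter fun S : Finset (BlowupVertex X m) => IsBlowupIndep R m S).card /
        (2 ^ m - 1) ^ Fintype.card X =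
      (univ.filter fun D : Finset X => IsLowerFinset R D).card := by
  obtain ⟨-, hlt⟩ := card_indep_sub_lt R m hR h
  rw [card_indep_eq_add R m hR, Nat.add_sub_cancel_left] at hlt
  have hq : 0 < (2 ^ m - 1) ^ Fintype.card X :=
    pow_pos (lt_of_le_of_lt (Nat.zero_le _) h) _
  rw [card_indep_eq_add R m hR, Nat.mul_add_div hq, Nat.div_eq_of_lt (by omega), add_zero]

/-- The printed threshold: `4 · 3^n < 2^{2n} − 1` for `n ≥ 5` (i.e.
`3^n (2^{2n} − 1)^{n−1} / (2^{2n} − 1)^n < 1/4`, "at least for `n ≥ 5`").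
[cite: DyerEtAl2003, Lemma 9 (proof)] -/
theorem four_mul_three_pow_lt_of_five_le {n : ℕ} (hn : 5 ≤ n) : 4 * 3 ^ n < 2 ^ (2 * n) - 1 := by
  suffices h : 4 * 3 ^ n + 1 < 2 ^ (2 * n) by omega
  induction n, hn using Nat.le_induction with
  | base => norm_num
  | succ k _ ih =>
    have e1 : 3 ^ (k + 1) = 3 ^ k * 3 := pow_succ 3 k
    have e2 : 2 ^ (2 * (k + 1)) = 2 ^ (2 * k) * 4 := by
      rw [show 2 * (k + 1) = 2 * k + 2 by ring, pow_add]
      norm_num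
    rw [e1, e2]
    omega

/-- **Lemma 9 with the printed parameters**: for a reflexive relation on `Fin n`, `n ≥ 5`, and
blocks of size `2n`, `|𝓓| = ⌊|𝓘(B)| / (2^{2n} − 1)^n⌋`. [cite: DyerEtAl2003, Lemma 9] -/
theorem card_indep_div_eq_of_five_le {n : ℕ} (hn : 5 ≤ n) (R : Fin n → Fin n → Prop)
    [DecidableRel R] (hR : ∀ i, R i i) :
    (univ.filter fun S : Finset (BlowupVertex (Fin n) (2 * n)) => IsBlowupIndep R (2 * n) S).card /
        (2 ^ (2 * n) - 1) ^ n =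
      (univ.filter fun D : Finset (Fin n) => IsLowerFinset R D).card := by
  have h := card_indep_div_eq R (2 * n) hR (by simpa using four_mul_three_pow_lt_of_five_le hn)
  simpa using h

end Counting

end Literature.Computability.Complexity.DyerEtAl2003
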